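import Literature.AlgebraicGeometry.AbelianSchemes.RoofLegsSpecialFibre                        -- ★ LA3-p01 p847969 (§1 bookkeeping) + ★ p847843 recognition + ★ p847713 cover leg
import Literature.AlgebraicGeometry.AbelianSchemes.AbelianSchemeHomReductionSpecialFibreIso   -- ★ (ν8d) p847682
import Literature.AlgebraicGeometry.AbelianSchemes.AbelianSchemeFibreFrobeniusTwistPolarization -- ★ (d3) LA3-p02 p847838∕p847900: the Frobenius-twist junction
import HarnessLib

/-!
# The Frobenius cover of the special fibre, I: RECOGNITION of the generic Serre cover (`E : 𝒞_x ≅ 𝒜_{x″}`, `ψ_x ≫ E = c`, with the laws of `E⁻¹`) and the cover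
# `u := ψ_{x̄′} ≫ ē⁻¹` from a reduced recognition isomorphism ([MumfordAV1970] §7, §15, §23; [Conrad2004GrossZagier] §7; [RapoportSmithlingZhang2020Diagonal] (4.23))

Topic `AlgebraicGeometry/AbelianSchemes`, namespace `Literature.AlgebraicGeometry.AbelianSchemes.AbelianSchemeOver`.  THEOREMS ONLY (no definition, no named fact,
no `instance`, no notation, no `sorry`).  Cell `hodgecm-mathlib` (D-0151), F0∕P6 «MOD», «GO 500» line L3 (socket `stub_FROB` of the D-line
`Cruxes/HLiu418/Lines/F0_P6a_DatumOfInputs.lean`), COVER ROAD A → `stub_TWISTCOVER0`'s cover conjunct (closer skeleton v4, A-p03 (g30) 06386a30; cover assembly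
statement `StubFROBCover.skeleton.v1` 418098d2, head `frobCover₀_of_coverΩ` ∕ `…_of_coverKerΩ`).  This file is the GENERIC (tuple-parametric) form of that head: from the
UPSTAIRS Serre cover between the fibres of ONE family `𝒜 → 𝓨` at two `Ω̄`-points `x, x″` of the generic fibre, with its kernel law (spine ED. 4 `CoverKerΩ`, K-law),
polarisation law with scalar `n`, `ι`-equivariance and level transport, it PRODUCES a cover of the Frobenius twist `(𝒜_{x̄})^{(q)}` by `𝒜_{x̄′}` (`x̄′ = red x`, `x̄` ANY special
point with `red x″ = x̄ ≫ F̃` — ★ `GaloisThickeningMovedSheetFrobenius` supplies it for `x = ℓ_e(σ•y)`, `x″ = ℓ_{e∘γ}(σ•y)`, `x̄ = red₀ y`) carrying the five clauses of the P6a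
letter `FrobCover₀ … 𝔞 n x̄′ x̄` in ★ currency (the Lines file repackages by `exact`, cf. the HOME tail `frobCover₀_of_movedCover`).  `--supports stmt-HodgeConjecture-24832`,
count-neutral.  HONEST LABEL: HC_CM is proved only modulo the cell's 2 remaining named inputs (hLiu418 24832, h413 24833) until rung 0 closes; this file discharges none.

## Mathematics (the route of A-p03 (g30)'s census v2 §3 rider, with the scalar bookkeeping of LA3-p02's Q-COV-λ)

`𝓨` a proper model at `v` (reduced, locally Noetherian), `𝒜 → 𝓨` commutative with `𝒪`-action `ι`, Serre data `(E′, P, Q, N)` presenting `𝔟 ≅ 𝔞⁻¹` (`𝔞 = (P_k)`,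
`QP = N`, `PQ = N·E′`, `N ≠ 0`), `𝒞 := 𝒜 ⊗_𝒪 𝔟` with translation `ψ : 𝒜 → 𝒞` (kernel `𝒜[𝔞]`, fppf), the pull-back POLARISATION `λ^{pull}` of `𝒞` (`ψ ≫ λ^{pull} ≫ ψ^∨ = λ ≫ [N²]`,
★ `serreTwistPolPull`), level structures `lvl`, `lvl′` with `lvl′.σ i = lvl.σ i ≫ ψ`, and integers `n, k` with `n·k = N²`.  UPSTAIRS at `x, x″` (characteristic `0`): a
surjective homomorphism `c : 𝒜_x → 𝒜_{x″}` with `Ker c(Ω̄) = 𝒜_x[𝔞](Ω̄)`, `c ≫ λ_{x″} ≫ c^∨ = λ_x ≫ [n]`, `ι_x(a) ≫ c = c ≫ ι_{x″}(a)`, `c(σ^a(x)) = σ^a(x″)`.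
(1) RECOGNITION (★ `exists_iso_coverLeg_comp_eq_of_forall_points_of_charZero`): `E : 𝒞_x ≅ 𝒜_{x″}` with `ψ_x ≫ E = c`.  (2) LAWS OF `E`: `ι`-equivariance by cancelling the
epimorphism `ψ_x`; level: `E(σ′^a(x)) = σ^a(x″)`; polarisation: `ψ_x ≫ (E ≫ (λ_{x″} ≫ [k]) ≫ E^∨) ≫ ψ_x^∨ = λ_x ≫ [nk] = λ_x ≫ [N²] = ψ_x ≫ λ^{pull}_x ≫ ψ_x^∨`, so by the
uniqueness of descent through `ψ_x`, `ψ_x^∨` (★ `comp_lam_comp_dualIsogenyOver_eq_of_pullback_eq`) `E ≫ (λ_{x″} ≫ [k]) ≫ E^∨ = λ^{pull}_x`, i.e. for the INVERSE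
`E⁻¹ ≫ λ^{pull}_x ≫ (E⁻¹)^∨ = λ_{x″} ≫ [k]` — a law between POLARISATIONS of the two families, the shape ★ (ν8)(iv) transports.  (3) REDUCTION (★ (ν8d) on `E⁻¹`, families
`𝒜`, `𝒞`, points `x″`, `x`): an isomorphism `ē : 𝒜_{x̄″} ≅ 𝒞_{x̄′}` with the three laws.  (4) The cover `u := ψ_{x̄′} ≫ ē⁻¹ : 𝒜_{x̄′} → 𝒜_{x̄″}` has kernel `𝒜_{x̄′}[𝔞]` on all
`T`-points and is surjective (★ `comp_coverLeg_eq_one_iff_forall_mem`, `surjective_coverLeg_left`, iso-invariance), is `ι`-equivariant, carries `σ^a(x̄′)` to `σ^a(x̄″)`, satisfies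
`u ≫ λ_{x̄″} ≫ u^∨ = λ_{x̄′} ≫ [n]` (compose `ψ_{x̄′}`'s law for `λ^{pull}` (scalar `N² = nk`) with `ē⁻¹`'s exactness, then divide by `[k]`, ★ `comp_lam_comp_dualIsogenyOver_of_comp_mulN`),
and has the Serre presentation (`u ≫ (ē ≫ d̄_a) = ι(a)`, `(ē ≫ d̄_a) ≫ u = ι″(a)` for `a ∈ 𝔞`, `d̄_a` from ★ `exists_serreTranslate_comp_eq_i_of_mem`).  (5) JUNCTION (★ (d3)
`exists_frobeniusTwist_cover_of_cover_of_presentation` along `x̄″ = x̄ ≫ F̃`): `c̄′ := u ≫ J : 𝒜_{x̄′} → (𝒜_{x̄})^{(q)}` with the five clauses against the twist.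

## Contents
* §1 bookkeeping: `inv_comp_eq_comp_inv_of_comp_eq_frobCover` (intertwiners pass to inverses), `map_inv_eq_of_map_hom_eq_frobCover` (points through an inverse).
* §2 **`exists_coverRecognition`** — the recognition isomorphism `E : 𝒞_x ≅ 𝒜_{x″}`, `ψ_x ≫ E = c`, with the three laws of `E⁻¹` (generic base, characteristic `0`).
* §3 **`exists_cover_of_reducedRecognition`** — the cover `u := ψ_{x′} ≫ ē⁻¹` with its six clauses from an isomorphism `ē` with the three laws (generic base).
* (file II, ★ `FrobeniusCoverSpecialFibre`) `exists_reducedRecognition` + the head `exists_frobCover_specialFibre`.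

## References
* [Shimura1998] G. Shimura, *Abelian varieties with complex multiplication and modular functions* (1998), §13.1 Thm. 1 (pp. 97–99), §18.6 (pp. 127–128).
* [SerreTate1968] J.-P. Serre, J. Tate, *Good reduction of abelian varieties*, Ann. of Math. 88 (1968), §1 (Lemma 2, Thm. 1).
* [MumfordAV1970] D. Mumford, *Abelian Varieties* (1970), §7 Thm. 4 (p. 72), §15 Thm. 1 (p. 143), §23 Thm. 2 (p. 231).
* [RapoportSmithlingZhang2020Diagonal] M. Rapoport, B. Smithling, W. Zhang (2020), §3.2 (p. 11), §4.3 (4.23) (p. 21).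
* [Conrad2004GrossZagier] B. Conrad, *Gross–Zagier revisited*, MSRI Publ. 49 (2004), §7 (Thm. 7.5).
* [MumfordFogartyKirwan1994] D. Mumford, J. Fogarty, F. Kirwan, *GIT*, 3rd ed. (1994), Ch. 6 §1 Cor. 6.8 (p. 118), Ch. 7 §2 Def. 7.1–7.2 (p. 129).
-/

set_option autoImplicit false

noncomputable section

set_option backward.isDefEq.respectTransparency false

open CategoryTheory CategoryTheory.Limits AlgebraicGeometry MonoidalCategory CartesianMonoidalCategory
open scoped MonObj CategoryTheory.Obj NumberField
open Literature.AlgebraicGeometry.Motives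
open IsDedekindDomain IsDedekindDomain.HeightOneSpectrum ValuativeRel
open Literature.NumberTheory.EllipticCurves (genericFibre specGenericPoint)
open Literature.NumberTheory.GaloisRepresentations (closureValuationSubring)
open Literature.NumberTheory.DiophantineGeometry

namespace Literature.AlgebraicGeometry.AbelianSchemes

namespace AbelianSchemeOver

universe u

/-! ## §1 Bookkeeping -/

section Bookkeeping

variable {𝒱 : Type*} [Category 𝒱] {Y Z : 𝒱}

/-- Intertwiners pass to the inverse: `f ≫ e = e ≫ g` gives `g ≫ e⁻¹ = e⁻¹ ≫ f`. [folklore] -/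
private theorem inv_comp_eq_comp_inv_of_comp_eq_frobCover (e : Y ≅ Z) {f : Y ⟶ Y} {g : Z ⟶ Z} (h : f ≫ e.hom = e.hom ≫ g) :
    g ≫ e.inv = e.inv ≫ f := by
  rw [Iso.comp_inv_eq, Category.assoc, Iso.eq_inv_comp, h]

end Bookkeeping

section PointsBookkeeping

variable {L : Type u} [Field L] {X Y : Over (Spec (.of L))}

/-- For an isomorphism `e` over `Spec L`: if `e` carries the point `P` to `Q`, then `e⁻¹` carries `Q` to `P`. [folklore] -/
private theorem map_inv_eq_of_map_hom_eq_frobCover (e : X ≅ Y) {Ω : Type u} [Field Ω] [Algebra L Ω] {P : AlgPoints X Ω} {Q : AlgPoints Y Ω}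
    (h : AlgPoints.map e.hom P = Q) : AlgPoints.map e.inv Q = P := by
  rw [← h, ← AlgPoints.map_comp_apply, Iso.hom_inv_id, AlgPoints.map_id_apply]

end PointsBookkeeping

section ActionBookkeeping

variable {S S' S'' : Scheme.{u}} {A : AbelianSchemeOver S} {O : Type*} [CommRing O] (act : A.RingAction O) (g : S' ⟶ S) (s : S'' ⟶ S') (a : O)

/-- The twice base-changed action is the twice base-changed endomorphism: `((ι ×_S S′) ×_{S′} S″)(a) = (ι(a) ×_S S′) ×_{S′} S″` (by construction of ★
`RingAction.baseChange`; the P6a letters spell the right-hand side, `(act₀Of … a x̄).hom.hom.hom`). [cite: GortzWedhorn2020, Section (4.7) (pp. 107–108)] -/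
theorem RingAction.baseChange_baseChange_i : ((act.baseChange g).baseChange s).i a = baseChangeHom (baseChangeHom (act.i a) g) s := rfl

end ActionBookkeeping

/-! ## §2 Upstairs: the recognition isomorphism `E : 𝒞_x ≅ 𝒜_{x″}` (`ψ_x ≫ E = c`) and its three laws, at two field points of any base (characteristic `0`) -/

section Recognition

variable {Y Y' : Scheme.{u}} [IsReduced Y] [IsLocallyNoetherian Y] (g : Y' ⟶ Y) {Ω : Type u} [Field Ω] [IsAlgClosed Ω] [CharZero Ω]
  (x x'' : Spec (.of Ω) ⟶ Y')
  {A : AbelianSchemeOver Y} {O : Type*} [CommRing O] (act : A.RingAction O) [IsCommMonObj A.X]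
  {m : ℕ} (E' : Matrix (Fin m) (Fin m) O) (hE' : E' * E' = E') (P : Matrix (Fin m) (Fin 1) O) (Q : Matrix (Fin 1) (Fin m) O) {N : ℕ}
  (D : A.DualPair) (Db : (serreTensor act E' hE').DualPair)
  (hD : Nonempty ((Scheme.Modules.pullback (DualPair.unitHatSlice D)).obj D.P ≅ SheafOfModules.unit _))
  (hDb : Nonempty ((Scheme.Modules.pullback (DualPair.unitHatSlice Db)).obj Db.P ≅ SheafOfModules.unit _))
  (pol : A.Polarization D)

set_option maxHeartbeats 400000 in
/-- **THE RECOGNITION ISOMORPHISM OF THE COVER AND ITS LAWS.**  For a surjective homomorphism `c : 𝒜_x → 𝒜_{x″}` between the fibres of `𝒜 ×_Y Y′` at two `Ω`-points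
(`Ω` algebraically closed of characteristic `0`) with `Ker c(Ω) = 𝒜_x[𝔞](Ω)`, `c ≫ λ_{x″} ≫ c^∨ = λ_x ≫ [n]`, `ι`-equivariance and `c(σ^a(x)) = σ^a(x″)`, and Serre data
`(E′, P, Q, N)` for `𝔞` with `n·k = N²`: there is an isomorphism of group schemes `E : 𝒞_x ≅ 𝒜_{x″}` (`𝒞 = 𝒜 ⊗_𝒪 𝔟`) with `ψ_x ≫ E = c` (★ KER-EQ∕recognition), whose INVERSE satisfies
(λ) `E⁻¹ ≫ λ^{pull}_x ≫ (E⁻¹)^∨ = λ_{x″} ≫ [k]` for the pull-back polarisation `λ^{pull}` (★ `serreTwistPolPull`) — a law between polarisations of the two families —,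
(ι) `ι_{x″}(a) ≫ E⁻¹ = E⁻¹ ≫ ι^𝒞_x(a)`, and (η) `E⁻¹(σ^a(x″)) = σ′^a(x)` for `lvl′.σ = lvl.σ ≫ ψ`.  (λ): `ψ_x ≫ (E ≫ (λ_{x″} ≫ [k]) ≫ E^∨) ≫ ψ_x^∨ = λ_x ≫ [nk] = λ_x ≫ [N²] =
ψ_x ≫ λ^{pull}_x ≫ ψ_x^∨` and the uniqueness of descent through `ψ_x`, `ψ_x^∨` (★ `comp_lam_comp_dualIsogenyOver_eq_of_pullback_eq`), then ★ `inv_comp_lam_comp_dualIsogenyOver_inv_of_eq`.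
[cite: MumfordAV1970, §7 Thm. 4 (p. 72), §15 Thm. 1 (p. 143), §23 Thm. 2 (p. 231)] [cite: Conrad2004GrossZagier, §7 (Thm. 7.5)] [cite: RapoportSmithlingZhang2020Diagonal, §3.2 (p. 11), §4.3 (4.23) (p. 21)] -/
theorem exists_coverRecognition
    (hN : N ≠ 0) (hP : E' * P = P) (hQ : Q * E' = Q)
    (hQP : Q * P = Matrix.scalar (Fin 1) (N : O)) (hPQ : P * Q = Matrix.scalar (Fin m) (N : O) * E')
    {𝔞 : Ideal O} (h𝔞 : Ideal.span (Set.range fun k => P k 0) = 𝔞) {n k : ℕ} (hk : n * k = N ^ 2)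
    {g₀ nlev : ℕ} (lvl : A.LevelStructure g₀ nlev) (lvl' : (serreTensor act E' hE').LevelStructure g₀ nlev)
    (hlvl : ∀ i, lvl'.σ i = lvl.σ i ≫ serreTranslate act E' hE' P)
    (c : ((A.baseChange g).baseChange x).X ⟶ ((A.baseChange g).baseChange x'').X) [IsMonHom c] [Surjective c.left]
    (hker : ∀ Pt : ((A.baseChange g).baseChange x).toAffine.toAbelianVariety.Points Ω,
      (AlgPoints.map c Pt : ((A.baseChange g).baseChange x'').toAffine.toAbelianVariety.Points Ω) = 1 ↔
        ∀ a ∈ 𝔞, (AlgPoints.map (((act.baseChange g).baseChange x).i a) Pt : ((A.baseChange g).baseChange x).toAffine.toAbelianVariety.Points Ω) = 1)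
    (hc3 : c ≫ ((pol.baseChange g).baseChange x'').lam ≫ DualPair.dualIsogenyOver c ((D.baseChange g).baseChange x) ((D.baseChange g).baseChange x'') =
      ((pol.baseChange g).baseChange x).lam ≫ ((D.baseChange g).baseChange x).hat.mulN n)
    (hc4 : ∀ a : O, ((act.baseChange g).baseChange x).i a ≫ c = c ≫ ((act.baseChange g).baseChange x'').i a)
    (hc5 : ∀ a : Fin g₀ ⊕ Fin g₀ → ZMod nlev,
      AlgPoints.map c ((A.baseChange g).restrictPt x ((lvl.baseChange g).section_ a)) = (A.baseChange g).restrictPt x'' ((lvl.baseChange g).section_ a)) :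
    ∃ (E : (((serreTensor act E' hE').baseChange g).baseChange x).X ≅ ((A.baseChange g).baseChange x'').X) (_ : IsMonHom E.hom) (_ : IsMonHom E.inv),
      baseChangeHom (baseChangeHom (serreTranslate act E' hE' P) g) x ≫ E.hom = c ∧
      -- (λ) the inverse is exact between the POLARISATIONS `λ^{pull}` and `λ ≫ [k]`
      E.inv ≫ (((serreTwistPolPull act E' hE' P Q D Db hD hDb pol hN hP hQ hQP hPQ).baseChange g).baseChange x).lam ≫
          DualPair.dualIsogenyOver E.inv ((D.baseChange g).baseChange x'') ((Db.baseChange g).baseChange x) =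
        ((pol.baseChange g).baseChange x'').lam ≫ ((D.baseChange g).baseChange x'').hat.mulN k ∧
      -- (ι) equivariance of the inverse
      (∀ a : O, ((act.baseChange g).baseChange x'').i a ≫ E.inv = E.inv ≫ (((serreAction act E' hE').baseChange g).baseChange x).i a) ∧
      -- (η) the inverse carries `σ^a(x″)` to `σ′^a(x)`
      (∀ a : Fin g₀ ⊕ Fin g₀ → ZMod nlev,
        AlgPoints.map E.inv ((A.baseChange g).restrictPt x'' ((lvl.baseChange g).section_ a)) =
          ((serreTensor act E' hE').baseChange g).restrictPt x ((lvl'.baseChange g).section_ a)) := by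
  haveI := isMonHom_serreTranslate act E' hE' P
  haveI := pol.isMonHom
  haveI : IsLocallyNoetherian (Spec (CommRingCat.of Ω)) := inferInstance
  haveI : IsReduced (Spec (CommRingCat.of Ω)) := inferInstance
  -- STEP 1 (★ recognition): `E : 𝒞_x ≅ 𝒜_{x″}` with `ψ_x ≫ E = c`
  obtain ⟨E, hE, hEmon, hEinv, -⟩ := exists_iso_coverLeg_comp_eq_of_forall_points_of_charZero g x act E' hE' P Q c hN hP hQ hQP hPQ h𝔞 hker
  haveI := hEmon
  haveI := hEinv
  -- the cover leg `ψ_x` and its properties (★ p847713)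
  haveI hψmon := isMonHom_coverLeg g x act E' hE' P
  haveI := flat_coverLeg_left g x act E' hE' P Q hN hP hQ hQP hPQ
  haveI := surjective_coverLeg_left g x act E' hE' P Q hN hP hQ hQP hPQ
  haveI := isFinite_coverLeg_left g x act E' hE' P Q hN hP hQ hQP hPQ
  haveI : QuasiCompact (baseChangeHom (baseChangeHom (serreTranslate act E' hE' P) g) x).left := inferInstance
  refine ⟨E, hEmon, hEinv, hE, ?_, ?_, ?_⟩
  · -- (λ) `E ≫ (λ_{x″} ≫ [k]) ≫ E^∨ = λ^{pull}_x`, then invert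
    have hDbη := DualPair.nonempty_unitHatSlice_baseChange_iso (g := x) _ (DualPair.nonempty_unitHatSlice_baseChange_iso (g := g) Db hDb)
    have hDη := DualPair.nonempty_unitHatSlice_baseChange_iso (g := x) _ (DualPair.nonempty_unitHatSlice_baseChange_iso (g := g) D hD)
    have hDη'' := DualPair.nonempty_unitHatSlice_baseChange_iso (g := x'') _ (DualPair.nonempty_unitHatSlice_baseChange_iso (g := g) D hD)
    haveI := ((pol.baseChange g).baseChange x'').isMonHom
    haveI := (((serreTwistPolPull act E' hE' P Q D Db hD hDb pol hN hP hQ hQP hPQ).baseChange g).baseChange x).isMonHom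
    haveI : IsCommMonObj ((D.baseChange g).baseChange x'').hat.X := ((D.baseChange g).baseChange x'').hat.isCommMonObj_of_isReduced_base
    haveI : IsMonHom (((D.baseChange g).baseChange x'').hat.mulN k) := ((D.baseChange g).baseChange x'').hat.isMonHom_mulN k
    haveI : IsMonHom (DualPair.dualIsogenyOver E.hom ((Db.baseChange g).baseChange x) ((D.baseChange g).baseChange x'')) :=
      DualPair.isMonHom_dualIsogenyOver E.hom _ _ hDη'' hDbη
    haveI : IsMonHom (baseChangeHom (baseChangeHom (serreTranslateInv act E' hE' Q) g) x) :=
      (haveI := isMonHom_serreTranslateInv act E' hE' Q; haveI := isMonHom_baseChangeHom (serreTranslateInv act E' hE' Q) g;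
        isMonHom_baseChangeHom _ x)
    -- `ψ_x ≫ λ^{pull}_x ≫ ψ_x^∨ = λ_x ≫ [N²]` (★ p847713 §3 on ★ `isExactTwistPol_serreTwistLamPull`)
    haveI : IsMonHom (serreTwistLamPull act E' hE' Q D Db pol) := isMonHom_serreTwistLamPull act E' hE' Q D Db hD hDb pol
    have hψl := coverLeg_comp_lam_comp_dualIsogenyOver_of_isExactTwistPol g act E' hE' P x D Db pol
      (isExactTwistPol_serreTwistLamPull act E' hE' P Q D Db hD pol hP hQ hQP)
    -- `c ≫ (λ_{x″} ≫ [k]) ≫ c^∨ = λ_x ≫ [n·k]`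
    have hck := comp_comp_mulN_comp_dualIsogenyOver ((D.baseChange g).baseChange x) ((D.baseChange g).baseChange x'') hDη hDη'' c
      ((pol.baseChange g).baseChange x).lam ((pol.baseChange g).baseChange x'').lam k hc3
    rw [hk] at hck
    -- descent uniqueness: `E ≫ (λ_{x″} ≫ [k]) ≫ E^∨ = λ^{pull}_x`
    have hEk : E.hom ≫ (((pol.baseChange g).baseChange x'').lam ≫ ((D.baseChange g).baseChange x'').hat.mulN k) ≫
        DualPair.dualIsogenyOver E.hom ((Db.baseChange g).baseChange x) ((D.baseChange g).baseChange x'') =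
          (((serreTwistPolPull act E' hE' P Q D Db hD hDb pol hN hP hQ hQP hPQ).baseChange g).baseChange x).lam := by
      refine comp_lam_comp_dualIsogenyOver_eq_of_pullback_eq (baseChangeHom (baseChangeHom (serreTranslate act E' hE' P) g) x)
        ((D.baseChange g).baseChange x) ((D.baseChange g).baseChange x'') ((Db.baseChange g).baseChange x) E _ _
        (DualPair.dualIsogenyOver (baseChangeHom (baseChangeHom (serreTranslateInv act E' hE' Q) g) x) ((Db.baseChange g).baseChange x) ((D.baseChange g).baseChange x))
        hN (dualIsogenyOver_coverLeg_comp_eq_pow_id g x act E' hE' P Q hP hQ hPQ _ _ hDbη) ?_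
      rw [DualPair.dualIsogenyOver_congr ((D.baseChange g).baseChange x) ((D.baseChange g).baseChange x'') (h₂ := inferInstance) hE, hE, hck,
        Polarization.baseChange_lam, Polarization.baseChange_lam, serreTwistPolPull_lam]
      simpa only [Polarization.baseChange_lam] using hψl
    exact inv_comp_lam_comp_dualIsogenyOver_inv_of_eq ((Db.baseChange g).baseChange x) ((D.baseChange g).baseChange x'') _ _ hDη'' E hEk
  · -- (ι) cancel the epimorphism `ψ_x` against (t4), then invert
    intro a
    refine inv_comp_eq_comp_inv_of_comp_eq_frobCover E ?_
    apply ((A.baseChange g).baseChange x).cancel_left_of_flat_surjective (baseChangeHom (baseChangeHom (serreTranslate act E' hE' P) g) x)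
    rw [← Category.assoc, ← i_comp_coverLeg g x act E' hE' P hP a, Category.assoc, hE, hc4 a, ← hE, Category.assoc]
  · -- (η) `E(σ′^a(x)) = E(ψ_x(σ^a(x))) = c(σ^a(x)) = σ^a(x″)`, then invert
    intro a
    refine map_inv_eq_of_map_hom_eq_frobCover E ?_
    rw [← map_coverLeg_restrictPt_section g x act E' hE' P lvl lvl' hlvl a, ← AlgPoints.map_comp_apply, hE, hc5 a]

end Recognition

/-! ## §3 Downstairs: the cover `u := ψ_{x̄′} ≫ ē⁻¹` from a reduced recognition isomorphism `ē` (any base) -/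

section Downstairs

variable {Y Y' : Scheme.{u}} [IsReduced Y] [IsLocallyNoetherian Y] (g : Y' ⟶ Y) {L : Type u} [Field L]
  (x' x'' : Spec (.of L) ⟶ Y')
  {A : AbelianSchemeOver Y} {O : Type*} [CommRing O] (act : A.RingAction O) [IsCommMonObj A.X]
  {m : ℕ} (E' : Matrix (Fin m) (Fin m) O) (hE' : E' * E' = E') (P : Matrix (Fin m) (Fin 1) O) (Q : Matrix (Fin 1) (Fin m) O) {N : ℕ}
  (D : A.DualPair) (Db : (serreTensor act E' hE').DualPair)
  (hD : Nonempty ((Scheme.Modules.pullback (DualPair.unitHatSlice D)).obj D.P ≅ SheafOfModules.unit _))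
  (hDb : Nonempty ((Scheme.Modules.pullback (DualPair.unitHatSlice Db)).obj Db.P ≅ SheafOfModules.unit _))
  (pol : A.Polarization D)

set_option maxHeartbeats 400000 in
/-- **THE COVER INTO THE SECOND FIBRE FROM A REDUCED RECOGNITION ISOMORPHISM.**  Over any reduced locally Noetherian `Y`, `g : Y′ → Y`, two `L`-points `x′, x″` of `Y′`
(`L` a field), Serre data for `𝔞` with `n·k = N²`, `lvl′.σ = lvl.σ ≫ ψ`: an isomorphism of group schemes `ē : 𝒜_{x″} ≅ 𝒞_{x′}` (`𝒞 = 𝒜 ⊗ 𝔟`) which is (λ) exact between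
`λ^{pull}_{x′}` and `λ_{x″} ≫ [k]`, (ι) equivariant and (η) carries `σ^a(x″)` to `σ′^a(x′)` yields the cover **`u := ψ_{x′} ≫ ē⁻¹ : 𝒜_{x′} → 𝒜_{x″}`** with (f1) the Serre
presentation of `𝔞` (`d := ē ≫ d̄_a`, ★ `exists_serreTranslate_comp_eq_i_of_mem`), (f1′) kernel `𝒜_{x′}[𝔞]` on all `T`-points and surjective (★ `comp_coverLeg_eq_one_iff_forall_mem`,
`surjective_coverLeg_left`), (f3) `u ≫ λ_{x″} ≫ u^∨ = λ_{x′} ≫ [n]` (ψ's law for `λ^{pull}`, scalar `N²`; exactness of `ē⁻¹`; division by `[k]`), (f4) equivariance (★ `i_comp_coverLeg`),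
(f5) `u(σ^a(x′)) = σ^a(x″)` (★ `map_coverLeg_restrictPt_section`). [cite: MumfordAV1970, §7 Thm. 4 (p. 72), §15 Thm. 1 (p. 143), §23 Thm. 2 (p. 231)]
[cite: Conrad2004GrossZagier, §7 (Thm. 7.5)] [cite: RapoportSmithlingZhang2020Diagonal, §4.3 (4.23) (p. 21)] -/
theorem exists_cover_of_reducedRecognition
    (hN : N ≠ 0) (hP : E' * P = P) (hQ : Q * E' = Q)
    (hQP : Q * P = Matrix.scalar (Fin 1) (N : O)) (hPQ : P * Q = Matrix.scalar (Fin m) (N : O) * E')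
    {𝔞 : Ideal O} (h𝔞 : Ideal.span (Set.range fun k => P k 0) = 𝔞) {n k : ℕ} (hk : n * k = N ^ 2)
    {g₀ nlev : ℕ} (lvl : A.LevelStructure g₀ nlev) (lvl' : (serreTensor act E' hE').LevelStructure g₀ nlev)
    (hlvl : ∀ i, lvl'.σ i = lvl.σ i ≫ serreTranslate act E' hE' P)
    (eb : ((A.baseChange g).baseChange x'').X ≅ (((serreTensor act E' hE').baseChange g).baseChange x').X) [IsMonHom eb.hom]
    (hebl : eb.hom ≫ ((((serreTwistPolPull act E' hE' P Q D Db hD hDb pol hN hP hQ hQP hPQ)).baseChange g).baseChange x').lam ≫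
        DualPair.dualIsogenyOver eb.hom ((D.baseChange g).baseChange x'') ((Db.baseChange g).baseChange x') =
      ((pol.baseChange g).baseChange x'').lam ≫ ((D.baseChange g).baseChange x'').hat.mulN k)
    (hebi : ∀ a : O, ((act.baseChange g).baseChange x'').i a ≫ eb.hom = eb.hom ≫ (((serreAction act E' hE').baseChange g).baseChange x').i a)
    (hebs : ∀ a : Fin g₀ ⊕ Fin g₀ → ZMod nlev,
      AlgPoints.map eb.hom ((A.baseChange g).restrictPt x'' ((lvl.baseChange g).section_ a)) =
        ((serreTensor act E' hE').baseChange g).restrictPt x' ((lvl'.baseChange g).section_ a)) :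
    ∃ (u : ((A.baseChange g).baseChange x').X ⟶ ((A.baseChange g).baseChange x'').X) (_ : IsMonHom u),
      (∀ a : O, a ∈ 𝔞 → ∃ d : ((A.baseChange g).baseChange x'').X ⟶ ((A.baseChange g).baseChange x').X,
        u ≫ d = ((act.baseChange g).baseChange x').i a ∧ d ≫ u = ((act.baseChange g).baseChange x'').i a) ∧
      (∀ ⦃T : Over (Spec (.of L))⦄ (t : T ⟶ ((A.baseChange g).baseChange x').X),
        t ≫ u = 1 ↔ ∀ a ∈ 𝔞, t ≫ ((act.baseChange g).baseChange x').i a = 1) ∧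
      Function.Surjective u.left.base ∧
      u ≫ ((pol.baseChange g).baseChange x'').lam ≫ DualPair.dualIsogenyOver u ((D.baseChange g).baseChange x') ((D.baseChange g).baseChange x'') =
        ((pol.baseChange g).baseChange x').lam ≫ ((D.baseChange g).baseChange x').hat.mulN n ∧
      (∀ a : O, ((act.baseChange g).baseChange x').i a ≫ u = u ≫ ((act.baseChange g).baseChange x'').i a) ∧
      (∀ a : Fin g₀ ⊕ Fin g₀ → ZMod nlev,
        AlgPoints.map u ((A.baseChange g).restrictPt x' ((lvl.baseChange g).section_ a)) = (A.baseChange g).restrictPt x'' ((lvl.baseChange g).section_ a)) := by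
  haveI := isMonHom_serreTranslate act E' hE' P
  haveI := pol.isMonHom
  haveI : IsMonHom eb.inv := inferInstance
  haveI hψmon := isMonHom_coverLeg g x' act E' hE' P
  refine ⟨(baseChangeHom (baseChangeHom (serreTranslate act E' hE' P) g) x') ≫ eb.inv, inferInstance, ?_, ?_, ?_, ?_, ?_, ?_⟩
  · -- (f1) the Serre presentation: `d := ē ≫ d̄_a` with `ψ ≫ d̄_a = ι(a)`, `d̄_a ≫ ψ = ι^𝒞(a)`
    intro a ha
    haveI := act.isMonHom a
    haveI := flat_serreTranslate_left act E' hE' P Q hN hP hQ hQP hPQ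
    haveI := surjective_serreTranslate_left act E' hE' P Q hN hP hQ hQP hPQ
    haveI := quasiCompact_serreTranslate_left act E' hE' P Q hN hP hQ hQP hPQ
    obtain ⟨d₀, hd₀mon, hd₀⟩ := exists_serreTranslate_comp_eq_i_of_mem act E' hE' P Q hN hP hQ hQP hPQ h𝔞 ha
    haveI := hd₀mon
    have hd₀' : d₀ ≫ serreTranslate act E' hE' P = (serreAction act E' hE').i a := by
      apply A.cancel_left_of_flat_surjective (serreTranslate act E' hE' P)
      rw [← Category.assoc, hd₀, i_comp_serreTranslate act E' hE' P hP a]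
    have hd₁ : (baseChangeHom (baseChangeHom (serreTranslate act E' hE' P) g) x') ≫ baseChangeHom (baseChangeHom d₀ g) x' = ((act.baseChange g).baseChange x').i a := by
      change (Over.pullback x').map ((Over.pullback g).map (serreTranslate act E' hE' P)) ≫ (Over.pullback x').map ((Over.pullback g).map d₀) =
        (Over.pullback x').map ((Over.pullback g).map (act.i a))
      rw [← Functor.map_comp, ← Functor.map_comp, hd₀]
    have hd₂ : baseChangeHom (baseChangeHom d₀ g) x' ≫ (baseChangeHom (baseChangeHom (serreTranslate act E' hE' P) g) x') = (((serreAction act E' hE').baseChange g).baseChange x').i a := by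
      change (Over.pullback x').map ((Over.pullback g).map d₀) ≫ (Over.pullback x').map ((Over.pullback g).map (serreTranslate act E' hE' P)) =
        (Over.pullback x').map ((Over.pullback g).map ((serreAction act E' hE').i a))
      rw [← Functor.map_comp, ← Functor.map_comp, hd₀']
    refine ⟨eb.hom ≫ baseChangeHom (baseChangeHom d₀ g) x', ?_, ?_⟩
    · rw [Category.assoc, eb.inv_hom_id_assoc, hd₁]
    · rw [Category.assoc, ← Category.assoc (baseChangeHom _ _), hd₂, ← Category.assoc, ← hebi a, Category.assoc, eb.hom_inv_id, Category.comp_id]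
  · -- (f1′) kernel law: `ψ_{x′}`'s (★ `comp_coverLeg_eq_one_iff_forall_mem`), unchanged by the isomorphism `ē⁻¹`
    exact comp_kernel_iff_of_mono (baseChangeHom (baseChangeHom (serreTranslate act E' hE' P) g) x') eb.inv (fun _ t => ∀ a ∈ 𝔞, t ≫ ((act.baseChange g).baseChange x').i a = 1)
      (comp_coverLeg_eq_one_iff_forall_mem g x' act E' hE' P hP h𝔞)
  · -- surjectivity
    have h1 : Function.Surjective (baseChangeHom (baseChangeHom (serreTranslate act E' hE' P) g) x').left.base := (surjective_coverLeg_left g x' act E' hE' P Q hN hP hQ hQP hPQ).surj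
    have h2 : Function.Surjective eb.inv.left.base := (Scheme.homeoOfIso ((Over.forget _).mapIso eb.symm)).surjective
    rw [Over.comp_left, Scheme.Hom.comp_base, TopCat.coe_comp]
    exact h2.comp h1
  · -- (f3) `ψ_{x′}` with `λ^{pull}` (scalar `N² = nk`), `ē⁻¹` exact for (`λ ≫ [k]`, `λ^{pull}`), then divide by `[k]`
    have hDbs := DualPair.nonempty_unitHatSlice_baseChange_iso (g := x') _ (DualPair.nonempty_unitHatSlice_baseChange_iso (g := g) Db hDb)
    have hDs := DualPair.nonempty_unitHatSlice_baseChange_iso (g := x') _ (DualPair.nonempty_unitHatSlice_baseChange_iso (g := g) D hD)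
    have hDs'' := DualPair.nonempty_unitHatSlice_baseChange_iso (g := x'') _ (DualPair.nonempty_unitHatSlice_baseChange_iso (g := g) D hD)
    haveI : IsMonHom (serreTwistLamPull act E' hE' Q D Db pol) := isMonHom_serreTwistLamPull act E' hE' Q D Db hD hDb pol
    haveI := ((pol.baseChange g).baseChange x').isMonHom
    haveI := ((pol.baseChange g).baseChange x'').isMonHom
    haveI := ((((serreTwistPolPull act E' hE' P Q D Db hD hDb pol hN hP hQ hQP hPQ)).baseChange g).baseChange x').isMonHom
    haveI : IsCommMonObj ((D.baseChange g).baseChange x'').hat.X := ((D.baseChange g).baseChange x'').hat.isCommMonObj_of_isReduced_base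
    haveI : IsMonHom (((D.baseChange g).baseChange x'').hat.mulN k) := ((D.baseChange g).baseChange x'').hat.isMonHom_mulN k
    have hk0 : k ≠ 0 := by
      rintro rfl
      exact pow_ne_zero 2 hN (by simpa using hk.symm)
    have hψs : (baseChangeHom (baseChangeHom (serreTranslate act E' hE' P) g) x') ≫ ((((serreTwistPolPull act E' hE' P Q D Db hD hDb pol hN hP hQ hQP hPQ)).baseChange g).baseChange x').lam ≫
        DualPair.dualIsogenyOver (baseChangeHom (baseChangeHom (serreTranslate act E' hE' P) g) x') ((D.baseChange g).baseChange x') ((Db.baseChange g).baseChange x') =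
          ((pol.baseChange g).baseChange x').lam ≫ ((D.baseChange g).baseChange x').hat.mulN (N ^ 2) := by
      have h := coverLeg_comp_lam_comp_dualIsogenyOver_of_isExactTwistPol g act E' hE' P x' D Db pol
        (isExactTwistPol_serreTwistLamPull act E' hE' P Q D Db hD pol hP hQ hQP)
      simpa only [Polarization.baseChange_lam, serreTwistPolPull_lam] using h
    have hebinv : eb.inv ≫ (((pol.baseChange g).baseChange x'').lam ≫ ((D.baseChange g).baseChange x'').hat.mulN k) ≫
        DualPair.dualIsogenyOver eb.inv ((Db.baseChange g).baseChange x') ((D.baseChange g).baseChange x'') =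
          ((((serreTwistPolPull act E' hE' P Q D Db hD hDb pol hN hP hQ hQP hPQ)).baseChange g).baseChange x').lam := by
      convert inv_comp_lam_comp_dualIsogenyOver_inv_of_eq ((D.baseChange g).baseChange x'') ((Db.baseChange g).baseChange x')
        (((pol.baseChange g).baseChange x'').lam ≫ ((D.baseChange g).baseChange x'').hat.mulN k)
        ((((serreTwistPolPull act E' hE' P Q D Db hD hDb pol hN hP hQ hQP hPQ)).baseChange g).baseChange x').lam hDbs eb hebl using 2
    have hcomp : ((baseChangeHom (baseChangeHom (serreTranslate act E' hE' P) g) x') ≫ eb.inv) ≫ (((pol.baseChange g).baseChange x'').lam ≫ ((D.baseChange g).baseChange x'').hat.mulN k) ≫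
        DualPair.dualIsogenyOver ((baseChangeHom (baseChangeHom (serreTranslate act E' hE' P) g) x') ≫ eb.inv) ((D.baseChange g).baseChange x') ((D.baseChange g).baseChange x'') =
          ((pol.baseChange g).baseChange x').lam ≫ ((D.baseChange g).baseChange x').hat.mulN (n * k) := by
      rw [hk, DualPair.dualIsogenyOver_comp (baseChangeHom (baseChangeHom (serreTranslate act E' hE' P) g) x') eb.inv ((D.baseChange g).baseChange x') ((Db.baseChange g).baseChange x')
        ((D.baseChange g).baseChange x''), ← hψs, ← hebinv]
      simp only [Category.assoc]
    exact comp_lam_comp_dualIsogenyOver_of_comp_mulN ((D.baseChange g).baseChange x') ((D.baseChange g).baseChange x'') hDs hDs''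
      ((baseChangeHom (baseChangeHom (serreTranslate act E' hE' P) g) x') ≫ eb.inv) ((pol.baseChange g).baseChange x').lam ((pol.baseChange g).baseChange x'').lam hk0 hcomp
  · -- (f4) equivariance (★ `i_comp_coverLeg` and (ι) inverted)
    intro a
    have h1 := i_comp_coverLeg g x' act E' hE' P hP a
    have h2 : (((serreAction act E' hE').baseChange g).baseChange x').i a ≫ eb.inv = eb.inv ≫ ((act.baseChange g).baseChange x'').i a :=
      inv_comp_eq_comp_inv_of_comp_eq_frobCover eb (hebi a)
    rw [← Category.assoc, h1]
    simp only [Category.assoc]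
    rw [h2]
  · -- (f5) level points (★ `map_coverLeg_restrictPt_section` and (η) inverted)
    intro a
    rw [AlgPoints.map_comp_apply, map_coverLeg_restrictPt_section g x' act E' hE' P lvl lvl' hlvl a]
    exact map_inv_eq_of_map_hom_eq_frobCover eb (hebs a)

end Downstairs

end AbelianSchemeOver

end Literature.AlgebraicGeometry.AbelianSchemes

end
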